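import Mathlib
import HarnessLib
import Literature.Analysis.FluidPDE.SelfSimilar
import Literature.Analysis.FluidPDE.LocalTypeI
import Literature.Analysis.FluidPDE.VectorCalculus
import Literature.Analysis.FluidPDE.BiotSavartCurlPair
import Literature.Analysis.FluidPDE.TypeIAncientMild
import Literature.Analysis.FluidPDE.TypeIAncientMildClassical
import Literature.Analysis.FluidPDE.ChaeAsymptoticallySelfSimilarProfile
import Literature.Analysis.FluidPDE.TsaiSelfSimilarBounded
import Literature.Analysis.UnboundedOperators.HeatKernel
import Summits.NavierStokesRegularity.NavierStokesRegularity.Theorems.LocalSineTubeDoorProfileAlignedWindowRigidity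
import Summits.NavierStokesRegularity.NavierStokesRegularity.Theorems.PoloidalWindowDoorPoloidalWindowRigidityWindow
import Summits.NavierStokesRegularity.NavierStokesRegularity.Theorems.PoloidalWindowDoorPoloidalWindowRigidityFlat

/-!
# Route `PoloidalWindowDoor` (staged, nsreg-p1), crux `PoloidalWindowRigidity` — three further SETTLED strata of the
# open stub `stub_nonflatLiouville`: unidirectional vorticity (R7, rank one), two poloidal directions (R7), and the
# self-similar / time-periodic profiles (R8-e, Tsai 1998)

Cell ns-regularity-ideate, seat p6 (route-directed support; land `--supports <PoloidalWindowRigidity item>` once the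
route is born). Ports of the cell's kernel rungs (nsreg-p1 ROUND-7/8, Sketch8A `poloidalRigidity_rung_aligned` L4665,
`poloidalRigidity_rung_twoDirections` L4675, `poloidalRigidity_rung_selfSimilar` L5298) over the class hypotheses of
the K2 skeleton (Type-I rate, continuity on the open slab, unit-viscosity Oseen-mild identity, divergence-free
slices; no cell structures), plus two elementary consequences of the Type-I gauge:

* `eq_zero_of_aligned` / `nonflatLiouville_of_aligned` — (R7, rank one) if ONE vorticity slice is everywhere parallel
  to one fixed `b ≠ 0`, the profile vanishes identically (the tree theorem of item stmt-…-20018,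
  `…LocalSineTubeDoorProfileAlignedWindowRigidity.eq_zero_of_aligned_window`, window `= univ`); so the residue of K2
  lives on profiles whose vorticity is unidirectional on NO slice;
* `eq_zero_of_twoDirections` / `nonflatLiouville_of_twoDirections` — (R7) poloidal along two independent directions
  `e₁, e₂` (`e₁ × e₂ ≠ 0`) forces `curl v ∥ e₁ × e₂` (BAC − CAB, tree `cross_cross_right`), hence the profile vanishes;
  K2 is new for ONE direction only;
* `eq_zero_of_selfSimilar` / `nonflatLiouville_of_selfSimilar` — (R8-e) a profile of the class of Leray's backward
  self-similar form `v = lerayBackward a 0 U` on the slab (`a > 0`) vanishes identically: with the KNSS pressure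
  (`IsTypeIAncientMild.exists_isClassicalNSSolutionOn_Ioo`) Leray's reduction makes `(U, p(−(2a)⁻¹))` a bounded Leray
  profile (`isLerayProfile_of_isClassical_lerayBackward`), Tsai 1998 Thm 1 (`q = ∞`,
  `IsLerayProfile.exists_eq_const_of_bounded`) makes `U` constant, and the Type-I gauge kills constants
  (`IsTypeIAncientMild.eq_zero_of_slice_const`) — NO poloidality needed;
* `eq_zero_of_scaleInvariant` / `nonflatLiouville_of_scaleInvariant` — the same stratum in invariant form: a profile
  fixed by every parabolic rescaling `v ↦ λ v(λ² ·, λ ·)`, `λ > 0`, is `lerayBackward ½ 0 (v(−1))` on the slab;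
* `eq_zero_of_timePeriodic` / `eq_zero_of_steady` — profiles of the class that are periodic (in particular constant)
  in time vanish: `‖v(t,y)‖ = ‖v(t − nP, y)‖ ≤ C/√(nP − t) → 0` (the gauge; elementary).

WHAT THIS IS NOT: not a claim about Navier–Stokes regularity and not the open stub — settled strata of it, for a STAGED
door route (bears_on LADDER-NS N0, rung N0-LocalTubeDoorPoloidal).
-/

noncomputable section

-- the summit and its single sub-problem share the name (CONVENTIONS §1), as in every Theorems file
set_option linter.dupNamespace false

namespace Summit.NavierStokesRegularity.NavierStokesRegularity.Theorems.PoloidalWindowDoorPoloidalWindowRigidityStrata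

open MeasureTheory Set Function Filter Topology TopologicalSpace Metric
open scoped RealInnerProductSpace InnerProductSpace
open Literature.Analysis Literature.Analysis.FluidPDE
open Summit.NavierStokesRegularity.NavierStokesRegularity.Theorems.LocalSineTubeDoorProfileAlignedWindowRigidity
open Summit.NavierStokesRegularity.NavierStokesRegularity.Theorems.PoloidalWindowDoorPoloidalWindowRigidityWindow
open Summit.NavierStokesRegularity.NavierStokesRegularity.Theorems.PoloidalWindowDoorPoloidalWindowRigidityFlat

variable {C : ℝ} {v : ℝ → EuclideanSpace ℝ (Fin 3) → EuclideanSpace ℝ (Fin 3)}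

/-! ### (R7) unidirectional vorticity on one slice -/

/-- **(R7, rank one) A profile of the class whose vorticity is, on ONE slice `s < 0`, everywhere parallel to one fixed
`b ≠ 0` vanishes identically** (tree `eq_zero_of_aligned_window` with the window `univ`). -/
theorem eq_zero_of_aligned (hrate : HasTypeITimeDecay C v)
    (hcont : ContinuousOn (uncurry v) (Iio (0 : ℝ) ×ˢ univ))
    (hmild : ∀ s t : ℝ, s < t → t < 0 → ∀ x,
      v t x = UnboundedOperators.heatExtension (v s) (t - s) x - oseenDuhamel 1 s v v t x)
    (hdiv : ∀ t < 0, VectorCalculus.IsDivFree (v t)) {b : EuclideanSpace ℝ (Fin 3)} (hb : b ≠ 0)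
    {s : ℝ} (hs : s < 0) (hal : ∀ y, cross (curl (v s) y) b = 0) : ∀ t < 0, ∀ x, v t x = 0 :=
  eq_zero_of_aligned_window hrate hcont hmild hdiv hs hb isOpen_univ univ_nonempty fun y _ => hal y

/-- **(R7) The unidirectional-vorticity stratum of the stub is empty**: vorticity parallel to a fixed `b ≠ 0` on every
slice ⇒ not backward-singular. -/
theorem nonflatLiouville_of_aligned (hrate : HasTypeITimeDecay C v)
    (hcont : ContinuousOn (uncurry v) (Iio (0 : ℝ) ×ˢ univ))
    (hmild : ∀ s t : ℝ, s < t → t < 0 → ∀ x,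
      v t x = UnboundedOperators.heatExtension (v s) (t - s) x - oseenDuhamel 1 s v v t x)
    (hdiv : ∀ t < 0, VectorCalculus.IsDivFree (v t)) {b : EuclideanSpace ℝ (Fin 3)} (hb : b ≠ 0)
    (hal : ∀ s < 0, ∀ y, cross (curl (v s) y) b = 0) : ¬ IsBackwardSingularPoint v 0 :=
  not_backwardSingular_of_zero
    (eq_zero_of_aligned hrate hcont hmild hdiv hb (by norm_num : (-1 : ℝ) < 0) (hal (-1) (by norm_num)))

/-! ### (R7) two poloidal directions -/

/-- **(R7) Poloidal along two independent directions ⇒ trivial.** If on one slice `s < 0` both `⟪curl v(s), e₁⟫ ≡ 0`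
and `⟪curl v(s), e₂⟫ ≡ 0` with `e₁ × e₂ ≠ 0`, then `curl v(s) × (e₁ × e₂) = ⟪curl v(s), e₂⟫ e₁ − ⟪curl v(s), e₁⟫ e₂ = 0`
(BAC − CAB), so the profile vanishes identically by the rank-one stratum. -/
theorem eq_zero_of_twoDirections (hrate : HasTypeITimeDecay C v)
    (hcont : ContinuousOn (uncurry v) (Iio (0 : ℝ) ×ˢ univ))
    (hmild : ∀ s t : ℝ, s < t → t < 0 → ∀ x,
      v t x = UnboundedOperators.heatExtension (v s) (t - s) x - oseenDuhamel 1 s v v t x)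
    (hdiv : ∀ t < 0, VectorCalculus.IsDivFree (v t)) {e₁ e₂ : EuclideanSpace ℝ (Fin 3)}
    (h12 : cross e₁ e₂ ≠ 0) {s : ℝ} (hs : s < 0) (h1 : ∀ y, ⟪curl (v s) y, e₁⟫_ℝ = 0)
    (h2 : ∀ y, ⟪curl (v s) y, e₂⟫_ℝ = 0) : ∀ t < 0, ∀ x, v t x = 0 := by
  refine eq_zero_of_aligned hrate hcont hmild hdiv h12 hs fun y => ?_
  rw [cross_cross_right, h1 y, h2 y, zero_smul, zero_smul, sub_zero]

/-- **(R7) The two-directions stratum of the stub is empty**: poloidal along `e₁` and along `e₂` with `e₁ × e₂ ≠ 0`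
on every slice ⇒ not backward-singular (so K2 has content for ONE direction only). -/
theorem nonflatLiouville_of_twoDirections (hrate : HasTypeITimeDecay C v)
    (hcont : ContinuousOn (uncurry v) (Iio (0 : ℝ) ×ˢ univ))
    (hmild : ∀ s t : ℝ, s < t → t < 0 → ∀ x,
      v t x = UnboundedOperators.heatExtension (v s) (t - s) x - oseenDuhamel 1 s v v t x)
    (hdiv : ∀ t < 0, VectorCalculus.IsDivFree (v t)) {e₁ e₂ : EuclideanSpace ℝ (Fin 3)}
    (h12 : cross e₁ e₂ ≠ 0) (h1 : ∀ s < 0, ∀ y, ⟪curl (v s) y, e₁⟫_ℝ = 0)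
    (h2 : ∀ s < 0, ∀ y, ⟪curl (v s) y, e₂⟫_ℝ = 0) : ¬ IsBackwardSingularPoint v 0 :=
  not_backwardSingular_of_zero
    (eq_zero_of_twoDirections hrate hcont hmild hdiv h12 (by norm_num : (-1 : ℝ) < 0)
      (h1 (-1) (by norm_num)) (h2 (-1) (by norm_num)))

/-! ### (R8-e) the self-similar stratum (Tsai 1998) -/

/-- **(R8-e) Self-similar profiles of the class are trivial** (no poloidality needed). If a profile of the route's
Type-I class has Leray's backward self-similar form on the slab, `v(s,y) = (2a(−s))^{-1/2} U((2a(−s))^{-1/2} y)` for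
`s < 0` (`a > 0`), then `v ≡ 0` on the slab: the class transfers to `lerayBackward a 0 U` (the Duhamel term only sees
negative times), the KNSS pressure makes it classical, Leray's reduction at `t₀ = −(2a)⁻¹` gives a bounded Leray
profile, Tsai's theorem (`q = ∞`) makes `U` constant and the Type-I gauge kills constants. -/
theorem eq_zero_of_selfSimilar {a : ℝ} (ha : 0 < a)
    {U : EuclideanSpace ℝ (Fin 3) → EuclideanSpace ℝ (Fin 3)} (hrate : HasTypeITimeDecay C v)
    (hcont : ContinuousOn (uncurry v) (Iio (0 : ℝ) ×ˢ univ))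
    (hmild : ∀ s t : ℝ, s < t → t < 0 → ∀ x,
      v t x = UnboundedOperators.heatExtension (v s) (t - s) x - oseenDuhamel 1 s v v t x)
    (hdiv : ∀ t < 0, VectorCalculus.IsDivFree (v t))
    (hss : ∀ s < 0, ∀ y, v s y = lerayBackward a 0 U s y) : ∀ t < 0, ∀ x, v t x = 0 := by
  -- ## transfer the class to `w := lerayBackward a 0 U` (everything only sees negative times)
  set w : ℝ → EuclideanSpace ℝ (Fin 3) → EuclideanSpace ℝ (Fin 3) := lerayBackward a 0 U with hw
  have hsl : ∀ s < 0, v s = w s := fun s hs => funext (hss s hs)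
  have hrate' : HasTypeITimeDecay C w := fun t ht x => by
    rw [← hss t ht x]
    exact hrate t ht x
  have hcont' : ContinuousOn (uncurry w) (Iio (0 : ℝ) ×ˢ univ) := by
    refine hcont.congr fun z hz => ?_
    have hz1 : z.1 < 0 := (mem_prod.1 hz).1
    show w z.1 z.2 = v z.1 z.2
    rw [hsl z.1 hz1]
  have hmild' : ∀ s t : ℝ, s < t → t < 0 → ∀ x,
      w t x = UnboundedOperators.heatExtension (w s) (t - s) x - oseenDuhamel 1 s w w t x := by
    intro s t hst ht x
    have hD : oseenDuhamel 1 s w w t x = oseenDuhamel 1 s v v t x := by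
      rw [oseenDuhamel_apply, oseenDuhamel_apply]
      refine setIntegral_congr_fun measurableSet_Ioo fun τ hτ => ?_
      simp only [hsl τ (hτ.2.trans ht)]
    rw [hD, ← hsl t ht, ← hsl s (hst.trans ht)]
    exact hmild s t hst ht x
  have hdiv' : ∀ t < 0, VectorCalculus.IsDivFree (w t) := fun t ht => by
    rw [← hsl t ht]
    exact hdiv t ht
  have hA : IsTypeIAncientMild C w := isTypeIAncientMild_of_class hrate' hcont' hmild' hdiv'
  -- ## Leray's reduction at the normalised time `t₀ = −(2a)⁻¹`, with the KNSS pressure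
  have h2a : 0 < (2 * a)⁻¹ := inv_pos.2 (by positivity)
  have ht₀ : (0 : ℝ) - (2 * a)⁻¹ < 0 := by linarith
  obtain ⟨p, hns⟩ := hA.exists_isClassicalNSSolutionOn_Ioo (t₀ := 0 - (2 * a)⁻¹ - 1) (by linarith)
  have hwt₀ : w (0 - (2 * a)⁻¹) = U := lerayBackward_apply_sub_inv ha 0 U
  have hU : ContDiff ℝ (⊤ : ℕ∞) U := by
    have h := hA.contDiff_slice ht₀
    rwa [hwt₀] at h
  have hint : (0 : ℝ) - (2 * a)⁻¹ ∈ interior (Ioo (0 - (2 * a)⁻¹ - 1) 0) := by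
    rw [isOpen_Ioo.interior_eq]
    exact ⟨by linarith, ht₀⟩
  have hprof : IsLerayProfile 1 a U (p (0 - (2 * a)⁻¹)) :=
    isLerayProfile_of_isClassical_lerayBackward ha hU hint hns
  -- ## bounded profile (Type-I bound at `t₀`) ⇒ constant (Tsai 1998, Thm 1, `q = ∞`)
  have hUbdd : ∃ M : ℝ, ∀ y, ‖U y‖ ≤ M :=
    ⟨C / Real.sqrt (-(0 - (2 * a)⁻¹)), fun y => by
      have h := hA.norm_le ht₀ y
      rwa [hwt₀] at h⟩
  obtain ⟨c, hc⟩ := hprof.exists_eq_const_of_bounded one_pos ha hUbdd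
  -- ## constant slices are killed by the gauge
  have hconst : ∀ s < 0, ∀ y : EuclideanSpace ℝ (Fin 3), w s y = w s 0 := fun s _ y => by
    simp only [hw, lerayBackward_apply, hc]
  intro t ht x
  rw [hss t ht x]
  exact hA.eq_zero_of_slice_const hconst ht x

/-- **(R8-e) The self-similar stratum of the stub is empty**: a profile of the class of Leray's backward self-similar
form on the slab is not backward-singular. -/
theorem nonflatLiouville_of_selfSimilar {a : ℝ} (ha : 0 < a)
    {U : EuclideanSpace ℝ (Fin 3) → EuclideanSpace ℝ (Fin 3)} (hrate : HasTypeITimeDecay C v)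
    (hcont : ContinuousOn (uncurry v) (Iio (0 : ℝ) ×ˢ univ))
    (hmild : ∀ s t : ℝ, s < t → t < 0 → ∀ x,
      v t x = UnboundedOperators.heatExtension (v s) (t - s) x - oseenDuhamel 1 s v v t x)
    (hdiv : ∀ t < 0, VectorCalculus.IsDivFree (v t))
    (hss : ∀ s < 0, ∀ y, v s y = lerayBackward a 0 U s y) : ¬ IsBackwardSingularPoint v 0 :=
  not_backwardSingular_of_zero (eq_zero_of_selfSimilar ha hrate hcont hmild hdiv hss)

/-- **Scale-invariant profiles are self-similar**: if `λ • v(λ² s, λ y) = v(s, y)` for all `λ > 0`, `s < 0`, then on the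
slab `v = lerayBackward ½ 0 (v(−1))`, i.e. `v(s,y) = (−s)^{-1/2} v(−1, (−s)^{-1/2} y)` (take `λ = (−s)^{-1/2}`). -/
theorem eq_lerayBackward_of_scaleInvariant
    (hsc : ∀ lam : ℝ, 0 < lam → ∀ s < 0, ∀ y, lam • v (lam ^ 2 * s) (lam • y) = v s y) :
    ∀ s < 0, ∀ y, v s y = lerayBackward (1 / 2) 0 (v (-1)) s y := by
  intro s hs y
  have hns : 0 < -s := neg_pos.2 hs
  have hsq : Real.sqrt (2 * (1 / 2) * (0 - s)) = Real.sqrt (-s) := by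
    congr 1
    ring
  have hl : 0 < (Real.sqrt (-s))⁻¹ := inv_pos.2 (Real.sqrt_pos.2 hns)
  have hl2 : (Real.sqrt (-s))⁻¹ ^ 2 * s = -1 := by
    rw [inv_pow, Real.sq_sqrt hns.le, inv_mul_eq_div, div_neg, div_self hs.ne]
  rw [lerayBackward_apply, hsq, ← hsc _ hl s hs y, hl2]

/-- **Scale-invariant profiles of the class are trivial** (the self-similar stratum in invariant form). -/
theorem eq_zero_of_scaleInvariant (hrate : HasTypeITimeDecay C v)
    (hcont : ContinuousOn (uncurry v) (Iio (0 : ℝ) ×ˢ univ))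
    (hmild : ∀ s t : ℝ, s < t → t < 0 → ∀ x,
      v t x = UnboundedOperators.heatExtension (v s) (t - s) x - oseenDuhamel 1 s v v t x)
    (hdiv : ∀ t < 0, VectorCalculus.IsDivFree (v t))
    (hsc : ∀ lam : ℝ, 0 < lam → ∀ s < 0, ∀ y, lam • v (lam ^ 2 * s) (lam • y) = v s y) :
    ∀ t < 0, ∀ x, v t x = 0 :=
  eq_zero_of_selfSimilar (a := 1 / 2) (by norm_num) hrate hcont hmild hdiv (eq_lerayBackward_of_scaleInvariant hsc)

/-- **The scale-invariant stratum of the stub is empty.** -/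
theorem nonflatLiouville_of_scaleInvariant (hrate : HasTypeITimeDecay C v)
    (hcont : ContinuousOn (uncurry v) (Iio (0 : ℝ) ×ˢ univ))
    (hmild : ∀ s t : ℝ, s < t → t < 0 → ∀ x,
      v t x = UnboundedOperators.heatExtension (v s) (t - s) x - oseenDuhamel 1 s v v t x)
    (hdiv : ∀ t < 0, VectorCalculus.IsDivFree (v t))
    (hsc : ∀ lam : ℝ, 0 < lam → ∀ s < 0, ∀ y, lam • v (lam ^ 2 * s) (lam • y) = v s y) :
    ¬ IsBackwardSingularPoint v 0 :=
  not_backwardSingular_of_zero (eq_zero_of_scaleInvariant hrate hcont hmild hdiv hsc)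

/-! ### time-periodic and steady profiles (the gauge) -/

/-- **Time-periodic fields with the Type-I rate vanish on the slab** (elementary: `‖v(t,y)‖ = ‖v(t − nP, y)‖ ≤
C/√(nP − t)` for every `n`, and the right-hand side tends to `0`). Only the rate is used. -/
theorem eq_zero_of_timePeriodic (hrate : HasTypeITimeDecay C v) {P : ℝ} (hP : 0 < P)
    (hper : ∀ s < 0, ∀ y, v (s - P) y = v s y) : ∀ t < 0, ∀ x, v t x = 0 := by
  intro t ht x
  -- backward iterates of the period
  have hiter : ∀ n : ℕ, v (t - n * P) x = v t x := by
    intro n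
    induction n with
    | zero => simp
    | succ n ih =>
      have hneg : t - n * P < 0 := by
        have : (0 : ℝ) ≤ n * P := by positivity
        linarith
      rw [← ih, ← hper _ hneg x]
      congr 1
      push_cast
      ring
  by_contra hne
  have hδ : 0 < ‖v t x‖ := norm_pos_iff.2 hne
  have hC : 0 ≤ C := by
    have h1 := hrate t ht x
    have h2 : 0 < Real.sqrt (-t) := Real.sqrt_pos.2 (neg_pos.2 ht)
    by_contra hC
    push Not at hC
    have : C / Real.sqrt (-t) < 0 := div_neg_of_neg_of_pos hC h2
    linarith [norm_nonneg (v t x)]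
  -- choose `n` with `C / √(nP − t) < ‖v t x‖`
  obtain ⟨n, hn⟩ : ∃ n : ℕ, (C / ‖v t x‖) ^ 2 / P < n := exists_nat_gt _
  have hnP : (C / ‖v t x‖) ^ 2 < n * P - t := by
    have h1 : (C / ‖v t x‖) ^ 2 < n * P := (div_lt_iff₀ hP).1 hn
    linarith
  have hneg : t - n * P < 0 := by
    have : (0 : ℝ) ≤ (C / ‖v t x‖) ^ 2 := sq_nonneg _
    linarith
  have key := hrate (t - n * P) hneg x
  rw [hiter n] at key
  have hsqrt : C / ‖v t x‖ < Real.sqrt (-(t - n * P)) := by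
    rw [show -(t - n * P) = n * P - t by ring]
    calc C / ‖v t x‖ ≤ |C / ‖v t x‖| := le_abs_self _
      _ = Real.sqrt ((C / ‖v t x‖) ^ 2) := (Real.sqrt_sq_eq_abs _).symm
      _ < Real.sqrt (n * P - t) := Real.sqrt_lt_sqrt (sq_nonneg _) hnP
  have hpos : 0 < Real.sqrt (-(t - n * P)) := Real.sqrt_pos.2 (neg_pos.2 hneg)
  -- `‖v t x‖ ≤ C / √(nP − t) < ‖v t x‖`
  have h3 : C / Real.sqrt (-(t - n * P)) < ‖v t x‖ := by
    rw [div_lt_iff₀ hpos]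
    calc C = C / ‖v t x‖ * ‖v t x‖ := by rw [div_mul_cancel₀ _ hδ.ne']
      _ < Real.sqrt (-(t - n * P)) * ‖v t x‖ := mul_lt_mul_of_pos_right hsqrt hδ
      _ = ‖v t x‖ * Real.sqrt (-(t - n * P)) := mul_comm _ _
  linarith

/-- **Steady fields with the Type-I rate vanish on the slab** (period `1`). -/
theorem eq_zero_of_steady (hrate : HasTypeITimeDecay C v) (hst : ∀ s t : ℝ, s < 0 → t < 0 → v s = v t) :
    ∀ t < 0, ∀ x, v t x = 0 :=
  eq_zero_of_timePeriodic hrate one_pos fun s hs y => by rw [hst (s - 1) s (by linarith) hs]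

/-- **The time-periodic stratum of the stub is empty**: a time-periodic field with the Type-I rate is not
backward-singular at the apex. -/
theorem nonflatLiouville_of_timePeriodic (hrate : HasTypeITimeDecay C v) {P : ℝ} (hP : 0 < P)
    (hper : ∀ s < 0, ∀ y, v (s - P) y = v s y) : ¬ IsBackwardSingularPoint v 0 :=
  not_backwardSingular_of_zero (eq_zero_of_timePeriodic hrate hP hper)

end Summit.NavierStokesRegularity.NavierStokesRegularity.Theorems.PoloidalWindowDoorPoloidalWindowRigidityStrata

end
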